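import Summits.Langlands.Langlands.Statement
import Literature.NumberTheory.Automorphic.KimShahidiFunctorialProductGL2GL3
import Literature.NumberTheory.Automorphic.GLnAdelicStructureProofs
import HarnessLib

/-!
# Line `RankinSelbergGL3GL3` — F3 SPECIAL-CASE FILE (forward generator G4 ladder-down, generation 25)
# top crux `IrreducibilityBySelfDuality.ReciprocityUpToIrreducibility` (stmt-Langlands-14328)

Dial θ27 = the pair of factor ranks `(m, n)` of the Rankin–Selberg product `⊠ : GL_m × GL_n → GL_{mn}` in
clause (B) of E, over EVERY number field `F`, automorphic inputs.  Contents (no `sorry`): §1 the a.e. tensor-lift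
predicate `IsTensorLiftAE` and the text family `WeakTensorProductFunctoriality m n` with the Kim–Shahidi text
`KimShahidi2002_functorialProduct_GL2GL3 := WeakTensorProductFunctoriality 2 3`; §2 the graded family
`RankinSelbergGaloisToAutomorphic m n` (target rank `m * n`), THE RUNG `RankinSelbergGL3GL3 := … 3 3` (rank 9) and
the floor decls `RankinSelbergGL2GL2`, `RankinSelbergGL2GL3`; §3 the bridge `of_weakTensorProductFunctoriality`;
§4 the floors `floor_two_two (h : Ramakrishnan2000_theoremM)` — THE IN-TREE WITNESS: Ramakrishnan 2000 Theorem M,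
the in-tree named fact `Literature.NumberTheory.Automorphic.Ramakrishnan2000_theoremM` [cite: Ramakrishnan2000,
Theorem M (§3)], target rank `2 * 2 = 4` by `rfl` — and `floor_two_three (h : KimShahidi2002_functorialProduct_GL2GL3)`
[cite: KimShahidi2002, Theorem A (p. 838) = Thm. 5.1], and the F3 instances
`example (h) : RankinSelbergGL2GL2 := floor_two_two h`, `example (h) : RankinSelbergGL2GL3 := floor_two_three h`.
-/

noncomputable section

set_option linter.dupNamespace false

open scoped MatrixGroups Matrix NumberField Classical Polynomial
open Filter IsDedekindDomain Field Polynomial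
open Literature.NumberTheory.Automorphic Literature.NumberTheory.GaloisRepresentations
open Literature.NumberTheory.PAdicHodge
open Summit.Langlands

namespace Summit.Langlands.Langlands.Cruxes.ReciprocityUpToIrreducibility.RankinSelbergGL3GL3

/-! ## 1. Weak tensor-product (Rankin–Selberg) lifts — IN TREE
`IsTensorLiftAE`, `WeakTensorProductFunctoriality m n` and the named fact
`KimShahidi2002_functorialProduct_GL2GL3 := WeakTensorProductFunctoriality 2 3` (Kim–Shahidi 2002 Thm A) are the
Literature declarations of `Literature/NumberTheory/Automorphic/KimShahidiFunctorialProductGL2GL3.lean` (p203420,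
vendored by this unit), used here BY NAME. -/

/-! ## 2. The graded family (dial = the pair of factor ranks `(m, n)`, target rank `m * n`) and the rung `(3,3)` -/

/-- **The rung family** `RankinSelbergGaloisToAutomorphic m n`: clause (B) of the summit (Galois ⇒ automorphic)
over EVERY number field `F`, at EVERY `ℓ` and `ι : ℚ̄_ℓ ≃ ℂ`, in the a.e.-Satake form, for irreducible
`ρ : Γ_F → GL_{mn}(ℚ̄_ℓ)` de Rham above `ℓ` (pinned Fontaine datum `fontainePstAdicCompletion`) whose Frobenius
characteristic polynomials are, at all but finitely many places, the `ι`-Satake polynomials of `α_v ⊗ β_v` for the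
Satake parameters `α_v`, `β_v` of a pair of CUSPIDAL `π₁` on `GL_m(𝔸_F)`, `π₂` on `GL_n(𝔸_F)` — the unramified
shadow of "`ρ ≅ ρ_{π₁} ⊗ ρ_{π₂}`", stated without assuming that `π₁`, `π₂` have Galois representations.
Conclusion: an AUTOMORPHIC `P` on `GL_{mn}(𝔸_F)` (Borel–Jacquet datum, not asserted cuspidal) with
`SatakeFrobCompatibleAt ι P ρ v` for almost all `v`.  Implied by the summit and by E for every `m, n ≥ 1`
(`…_of_langlands`, `…_of_top`); implied by `WeakTensorProductFunctoriality m n`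
(`of_weakTensorProductFunctoriality`), hence PROVED at `(2,2)` modulo the in-tree named fact and at `(2,3)` modulo
Kim–Shahidi Thm A; OPEN at `(3,3)` (`GL₃ × GL₃ → GL₉`). -/
def RankinSelbergGaloisToAutomorphic (m n : ℕ) : Prop :=
  ∀ (F : Type) [Field F] [NumberField F]
    (hm : Literature.NumberTheory.Automorphic.isCompact_glFiniteIntegralLevel m F)
    (hn : Literature.NumberTheory.Automorphic.isCompact_glFiniteIntegralLevel n F)
    (π₁ : Literature.NumberTheory.Automorphic.CuspidalAutomorphicRepData m F hm)
    (π₂ : Literature.NumberTheory.Automorphic.CuspidalAutomorphicRepData n F hn)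
    (ℓ : ℕ) [Fact ℓ.Prime] (ι : PadicAlgCl ℓ ≃+* ℂ)
    (ρ : Literature.NumberTheory.GaloisRepresentations.FramedGaloisRep F (PadicAlgCl ℓ) (m * n)),
    ρ.toGaloisRep.IsIrreducible →
    (∀ (v : IsDedekindDomain.HeightOneSpectrum (NumberField.RingOfIntegers F))
      (hv : ((ℓ : ℕ) : NumberField.RingOfIntegers F) ∈ v.asIdeal),
      (Literature.NumberTheory.PAdicHodge.fontainePstAdicCompletion v ℓ hv).IsDeRhamFramed (ρ.toLocal v)) →
    (∀ᶠ v : IsDedekindDomain.HeightOneSpectrum (NumberField.RingOfIntegers F) in Filter.cofinite,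
      ∃ α β : Multiset ℂ, π₁.1.HasSatakeParamAt v α ∧ π₂.1.HasSatakeParamAt v β ∧ ρ.IsUnramifiedAt v ∧
        ρ.HasFrobCharpolyAt v
          (Literature.NumberTheory.Automorphic.arithFrobPolyOfSatake ι v.residueCard 1
            (Literature.NumberTheory.Automorphic.satakeTensor α β))) →
    ∀ hcpt : Literature.NumberTheory.Automorphic.isCompact_glFiniteIntegralLevel (m * n) F,
      ∃ P : Literature.NumberTheory.Automorphic.AutomorphicRepData
          (Literature.NumberTheory.Automorphic.AutomorphyDatum.gl (m * n) F hcpt),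
        ∀ᶠ v : IsDedekindDomain.HeightOneSpectrum (NumberField.RingOfIntegers F) in Filter.cofinite,
          Summit.Langlands.SatakeFrobCompatibleAt ι P ρ v

/-- **THE RUNG** (the filed statement): the family at `(m, n) = (3, 3)` — clause (B) for irreducible de Rham
`GL₉`-representations of `GL₃ ⊠ GL₃` type over every number field. -/
def RankinSelbergGL3GL3 : Prop := RankinSelbergGaloisToAutomorphic 3 3

/-- The floor cell `(2,2)` of the family as a decl (decided modulo the in-tree named fact, `floor_two_two`). -/
def RankinSelbergGL2GL2 : Prop := RankinSelbergGaloisToAutomorphic 2 2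

/-- The floor cell `(2,3)` of the family as a decl (decided modulo Kim–Shahidi Thm A, `floor_two_three`). -/
def RankinSelbergGL2GL3 : Prop := RankinSelbergGaloisToAutomorphic 2 3

/-! ## 3. Weak functoriality at `(m,n)` gives the rung family at `(m,n)` -/

/-- **`WeakTensorProductFunctoriality m n → RankinSelbergGaloisToAutomorphic m n`**: the automorphic a.e. tensor
lift `P` of `(π₁, π₂)` has, at almost every `v`, the Satake parameter `α_v ⊗ β_v`, which is what the sector clause
says `ρ(Frob_v)` has as inverse-root data. [folklore] -/
theorem of_weakTensorProductFunctoriality {m n : ℕ} (h : WeakTensorProductFunctoriality m n) :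
    RankinSelbergGaloisToAutomorphic m n := by
  intro F _ _ hm hn π₁ π₂ ℓ _ ι ρ _hirr _hdR hsec hcpt
  obtain ⟨P, hP⟩ := h F hm hn hcpt π₁ π₂
  refine ⟨P, ?_⟩
  have hP' : ∀ᶠ v : HeightOneSpectrum (𝓞 F) in cofinite, ∀ α β : Multiset ℂ,
      π₁.1.HasSatakeParamAt v α → π₂.1.HasSatakeParamAt v β → P.HasSatakeParamAt v (satakeTensor α β) := hP
  filter_upwards [hsec, hP'] with v hv hPv
  obtain ⟨α, β, hπ₁, hπ₂, hur, hcp⟩ := hv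
  exact ⟨satakeTensor α β, hPv α β hπ₁ hπ₂, hur, hcp⟩

/-! ## 4. The floor cells `(2,2)` (Ramakrishnan 2000 Thm M, IN TREE as a named fact) and `(2,3)` (Kim–Shahidi) -/

/-- **Ramakrishnan's Theorem M gives weak tensor functoriality at `(2,2)`** (target rank `2 * 2 = 4` by `rfl`;
clause (i) of the in-tree named fact verbatim; the two level-`2` compactness witnesses are proofs of one
proposition). [cite: Ramakrishnan2000, Theorem M (§3)] -/
theorem weakTensorProductFunctoriality_two_two (h : Ramakrishnan2000_theoremM) :
    WeakTensorProductFunctoriality 2 2 :=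
  weakTensorProductFunctoriality_two_two_of_theoremM h

/-- **THE FLOOR `(2,2)` (PROVED modulo the in-tree named fact)**: clause (B) for irreducible de Rham
`ρ : Γ_F → GL₄(ℚ̄_ℓ)` of `GL₂ ⊠ GL₂` type, over every number field. [cite: Ramakrishnan2000, Theorem M] -/
theorem floor_two_two (h : Ramakrishnan2000_theoremM) : RankinSelbergGaloisToAutomorphic 2 2 :=
  of_weakTensorProductFunctoriality (weakTensorProductFunctoriality_two_two h)

/-- **THE FLOOR `(2,3)` (PROVED modulo Kim–Shahidi 2002 Thm A as a text)**: clause (B) for irreducible de Rham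
`ρ : Γ_F → GL₆(ℚ̄_ℓ)` of `GL₂ ⊠ GL₃` type, over every number field — THE WITNESS one step below the rung.
[cite: KimShahidi2002, Theorem A] -/
theorem floor_two_three (h : KimShahidi2002_functorialProduct_GL2GL3) : RankinSelbergGaloisToAutomorphic 2 3 :=
  of_weakTensorProductFunctoriality h

/-- F3 special-case instance at the floor cell `(2,2)`. -/
example (h : Ramakrishnan2000_theoremM) : RankinSelbergGL2GL2 := floor_two_two h

/-- F3 special-case instance at the floor cell `(2,3)`. -/
example (h : KimShahidi2002_functorialProduct_GL2GL3) : RankinSelbergGL2GL3 := floor_two_three h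

end Summit.Langlands.Langlands.Cruxes.ReciprocityUpToIrreducibility.RankinSelbergGL3GL3

end
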